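import Summits.CriticalPhenomena.PercolationContinuityZ3.Theorems.PercNearOneGluingNoHeavyQuantChemicalSphereSubmult
import Literature.Probability.Percolation.CriticalOneArmBKLowerBound
import Literature.Probability.Percolation.BernoulliPercolationProofs
import Mathlib.Analysis.SpecificLimits.Normed
import HarnessLib

/-!
# THE CHEMICAL SPHERES AT AND NEAR CRITICALITY: `E_p|∂B_int(0,k)| ≥ 1` for every `k` iff `p ≥ p_c`;
# `E_{p_c}|B_int(0,r)| ≥ r + 1` in EVERY dimension `d ≥ 2` (Kozma–Nachmias Thm 1.3(i), lower half, hypothesis-free);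
# the chemical Hammersley criterion and a characterisation of `p_c` — quant lane, seat p4 gen 39, file 2

builds on p205010 (kernel theorem, internal audit signed; external expert review pending) — NOT used in this file.
Seat `prim-quant-p4`, `--supports stmt-CriticalPhenomena-4575`; pure proofs, no definitions (`local notation3` only).

Notation (bond percolation `P_p` on `ℤ^d`): `L_p(k) = Σ_{x ∈ Λ_k} P_p(x ∈ ∂B_int(0,k)) = E_p|∂B_int(0,k)|` (expected size of the
`k`-th chemical sphere), `V_p(r) = Σ_{z ∈ Λ_r} P_p(z ∈ B_int(0,r)) = E_p|B_int(0,r)|` (expected intrinsic volume, gen 38's `S_p(r)`),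
`θ_n(p) = oneArmProb d p n`, `p_c = criticalProbI d`, `χ = chi d`.  Input: file 1's `θ_{mk}(p) ≤ L_p(k)^m`.

* §1 bookkeeping: `ChemSphere.real_mem_ball_eq_sum` (`P_p(z ∈ B_int(0,r)) = Σ_{k ≤ r} P_p(z ∈ ∂B_int(0,k))`),
  **`ChemSphere.sumBall_eq_sum_sumLevel`** (`V_p(r) = Σ_{k=0}^{r} L_p(k)`), `ChemSphere.sumLevel_zero` (`L_p(0) = 1`),
  `ChemSphere.real_far_le_sumLevel` (`P_p(Rad_int ≥ k) ≤ L_p(k)`, Markov).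
* §2 **`ChemSphere.one_le_sumLevel_criticalProbI`** — `E_{p_c}|∂B_int(0,k)| ≥ 1` for EVERY `k` and EVERY `d ≥ 2`: otherwise
  `θ_{mk}(p_c) ≤ L^m` would decay exponentially, against the tree's a-priori `π_{p_c}(n) ≥ c n^{-(d-1)/2}`
  (`exists_oneArmProb_criticalProbI_lower_half`).  **`ChemSphere.one_le_sumLevel_of_theta_pos`**, **`…_of_criticalProb_le`**:
  the same for every `p` with `θ(p) > 0`, hence for all `p ≥ p_c`.  The constant `1` is MEAN-FIELD EXACT (on the forward
  regular tree the critical generation sizes have expectation exactly `1`).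
* §3 **`ChemSphere.sumBall_criticalProbI_ge`** — `E_{p_c}|B_int(0,r)| ≥ r + 1` for every `r` and every `d ≥ 2` (sum of §2);
  `ChemSphere.sumBall_ge_of_criticalProb_le` (all `p ≥ p_c`).  This is the LOWER HALF of Kozma–Nachmias 2009 Thm 1.3(i) /
  Heydenreich–van der Hofstad (11.3.4) — printed for `d > 6` under the two-point function estimate `τ_{p_c}(0,x) ≍ |x|^{2-d}`;
  here with NO hypothesis, in every dimension, with the sharp constant.  With gen 38's Sapozhnikov upper bound
  (`ChemRad.sumBall_criticalProbI_le_linear_of_triangle`): **`ChemSphere.sumBall_criticalProbI_two_sided_of_triangle`**,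
  **`…_high_dim`** — `r + 1 ≤ E_{p_c}|B_int(0,r)| ≤ C r`, KN09 Thm 1.2(i)+1.3(i) fully in the kernel, unconditional for `d ≥ D`
  (census V145 of P4-MODULUS §43 DONE).
* §4 **`ChemSphere.exists_sumLevel_lt_one_of_lt_criticalProb`** — for `0 < p < p_c` some sphere `k ≤ χ(p) + 1` has
  `E_p|∂B_int(0,k)| < 1` (since `V_p(r) ≤ χ(p)`, gen 38), and then (file 1) `θ_n(p) ≤ L_p(k)^{⌊n/k⌋}`: the CHEMICAL HAMMERSLEY
  CRITERION; **`ChemSphere.lt_criticalProb_iff_exists_sumLevel_lt_one`** — for `0 < p`, `d ≥ 2`: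
  `p < p_c ⟺ ∃ k, E_p|∂B_int(0,k)| < 1`, i.e. `p_c = sup{p : some chemical sphere has expected size < 1}` — the intrinsic
  counterpart of Duminil-Copin–Tassion's `p_c = sup{p : φ_p(S) < 1 for some S}` (tree: `DCT16_tildeCriticalProb_eq_criticalProb`).

HONEST STATUS.  §2–§4 are NEW AS TYPED and elementary on file 1 + tree theorems (sharpness inputs: `π_{p_c}(n) ≥ c n^{-(d-1)/2}`,
`θ > 0` above `p_c`, `χ < ∞` below `p_c`); the high-dimensional two-sided statement reproduces KN09 Thm 1.2(i)/1.3(i) with the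
lower half freed of its hypothesis.  Presearch (corpus fts+vec, galaxy): no printed hypothesis-free linear lower bound for
`E_{p_c}|B_int(0,r)|` located (KN09, HvdH 2017 §11.3, Hutchcroft 2022 Prop 4.2 treat `d > 6` / the radius).  NO rate, NO exponent
for `d = 3`; (T1)/(T2) and the lane's honest sentence UNCHANGED.

References: G. Kozma, A. Nachmias, Invent. Math. 178 (2009) Thm 1.2(i), Thm 1.3(i) [KozmaNachmias2009]; M. Heydenreich,
R. van der Hofstad (2017) (11.3.4), Lemma 11.6 [HeydenreichVanDerHofstad2017]; H. Duminil-Copin, V. Tassion, Enseign. Math. 62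
(2016) Thm 1.1, §2.1 [DuminilCopinTassionEM2016]; J. M. Hammersley, Ann. Math. Statist. 28 (1957).
-/

noncomputable section

namespace Summit.CriticalPhenomena.PercolationContinuityZ3.Theorems

open MeasureTheory Set Filter Topology Literature.Probability.Percolation Literature.Probability.LatticeModels
open Literature.Probability.Percolation.Chemical Literature.Probability.Percolation.DCT16
open scoped Classical

namespace ChemSphere

variable {d : ℕ}

/-- `L_p(k) = Σ_{x ∈ Λ_k} P_p(x ∈ ∂B_int(0,k)) = E_p|∂B_int(0,k)|`. -/
local notation3 "SL[" p ", " k "]" =>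
  ∑ x ∈ box d k, (bondPercolation (zdGraph d) p).real {ω : BondConfig (Site d) | x ∈ level (zdGraph d) 0 k ω}

/-- `V_p(r) = Σ_{z ∈ Λ_r} P_p(z ∈ B_int(0,r)) = E_p|B_int(0,r)|` (gen 38's `S_p(r)`). -/
local notation3 "SB[" p ", " r "]" =>
  ∑ z ∈ box d r, (bondPercolation (zdGraph d) p).real {ω : BondConfig (Site d) | z ∈ ball (zdGraph d) 0 r ω}

/-! ### §1. Bookkeeping: `V_p(r) = Σ_{k ≤ r} L_p(k)`, `L_p(0) = 1`, `P_p(Rad_int ≥ k) ≤ L_p(k)` -/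

/-- Agreement on the lattice edges touching `Λ_n` gives agreement on the edges touching `B_int(0,n)`. [folklore] -/
theorem agree_of_inter_eq {n : ℕ} {ω ω' : BondConfig (Site d)}
    (h : ω ∩ ↑(edgesTouching (zdGraph d) (box d n)) = ω' ∩ ↑(edgesTouching (zdGraph d) (box d n))) :
    ∀ e ∈ (zdGraph d).edgeSet, (∃ y ∈ ball (zdGraph d) 0 n ω, y ∈ e) → (e ∈ ω ↔ e ∈ ω') := by
  intro e he hy
  obtain ⟨y, hy, hye⟩ := hy
  have hmem : e ∈ (↑(edgesTouching (zdGraph d) (box d n)) : Set (Sym2 (Site d))) := by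
    rw [coe_edgesTouching]; exact ⟨he, y, ChemRad.ball_subset_box n ω hy, hye⟩
  constructor
  · intro heω
    have : e ∈ ω' ∩ ↑(edgesTouching (zdGraph d) (box d n)) := h ▸ ⟨heω, hmem⟩
    exact this.1
  · intro heω'
    have : e ∈ ω ∩ ↑(edgesTouching (zdGraph d) (box d n)) := h.symm ▸ ⟨heω', hmem⟩
    exact this.1

/-- `{z ∈ ∂B_int(0,k)}` is determined by the lattice edges touching `Λ_k`. [folklore] -/
theorem determinedBy_mem_level (z : Site d) (k : ℕ) :
    DeterminedBy {ω : BondConfig (Site d) | z ∈ level (zdGraph d) 0 k ω} (↑(edgesTouching (zdGraph d) (box d k)) : Set (Sym2 (Site d))) := by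
  rw [determinedBy_iff]
  intro ω ω' h
  simp only [Set.mem_setOf_eq]
  rw [level_eq_of_agree (agree_of_inter_eq h) (i := k) (by omega)]

/-- `{z ∈ B_int(0,k)}` is determined by the lattice edges touching `Λ_k`. [folklore] -/
theorem determinedBy_mem_ball_touching (z : Site d) (k : ℕ) :
    DeterminedBy {ω : BondConfig (Site d) | z ∈ ball (zdGraph d) 0 k ω} (↑(edgesTouching (zdGraph d) (box d k)) : Set (Sym2 (Site d))) := by
  rw [determinedBy_iff]
  intro ω ω' h
  simp only [Set.mem_setOf_eq]
  rw [ball_eq_of_agree (agree_of_inter_eq h) (i := k) (by omega)]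

/-- `{z ∈ ∂B_int(0,k)}` is measurable. [folklore] -/
theorem measurableSet_mem_level (z : Site d) (k : ℕ) :
    MeasurableSet {ω : BondConfig (Site d) | z ∈ level (zdGraph d) 0 k ω} :=
  (determinedBy_mem_level z k).measurableSet_of_finset

/-- `{z ∈ B_int(0,r)}` is the disjoint union over `k ≤ r` of `{z ∈ ∂B_int(0,k)}`. [folklore] -/
theorem setOf_mem_ball_eq_biUnion (z : Site d) (r : ℕ) :
    {ω : BondConfig (Site d) | z ∈ ball (zdGraph d) 0 r ω} =
      ⋃ k ∈ Finset.range (r + 1), {ω : BondConfig (Site d) | z ∈ level (zdGraph d) 0 k ω} := by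
  ext ω
  simp only [Set.mem_setOf_eq, Set.mem_iUnion, Finset.mem_range, exists_prop]
  constructor
  · intro hz
    obtain ⟨hr, hd⟩ := mem_ball_iff.1 hz
    exact ⟨(openGraph ω ⊓ zdGraph d).dist 0 z, by omega, hr, rfl⟩
  · rintro ⟨k, hk, hz⟩
    exact ball_mono (show k ≤ r by omega) ω (level_subset_ball _ _ _ _ hz)

/-- **`P_p(z ∈ B_int(0,r)) = Σ_{k=0}^{r} P_p(z ∈ ∂B_int(0,k))`** (distinct chemical spheres are disjoint). [folklore] -/
theorem real_mem_ball_eq_sum (p : unitInterval) (z : Site d) (r : ℕ) :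
    (bondPercolation (zdGraph d) p).real {ω : BondConfig (Site d) | z ∈ ball (zdGraph d) 0 r ω} =
      ∑ k ∈ Finset.range (r + 1), (bondPercolation (zdGraph d) p).real {ω : BondConfig (Site d) | z ∈ level (zdGraph d) 0 k ω} := by
  rw [setOf_mem_ball_eq_biUnion, measureReal_biUnion_finset]
  · intro k _ k' _ hne
    rw [Function.onFun, Set.disjoint_left]
    intro ω hz hz'
    exact Set.disjoint_left.1 (disjoint_level hne ω) hz hz'
  · exact fun k _ => measurableSet_mem_level z k

/-- A site outside `Λ_k` is never on the `k`-th chemical sphere: `P_p(z ∈ ∂B_int(0,k)) = 0` for `z ∉ Λ_k`. [folklore] -/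
theorem real_mem_level_eq_zero_of_notMem_box (p : unitInterval) {z : Site d} {k : ℕ} (hz : z ∉ box d k) :
    (bondPercolation (zdGraph d) p).real {ω : BondConfig (Site d) | z ∈ level (zdGraph d) 0 k ω} = 0 := by
  have : {ω : BondConfig (Site d) | z ∈ level (zdGraph d) 0 k ω} = ∅ :=
    Set.eq_empty_of_forall_notMem fun ω hω => hz (level_subset_box k ω hω)
  rw [this, measureReal_empty]

/-- **`V_p(r) = Σ_{k=0}^{r} L_p(k)`**: the expected intrinsic volume is the sum of the expected sphere sizes. [folklore] -/
theorem sumBall_eq_sum_sumLevel (p : unitInterval) (r : ℕ) :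
    SB[p, r] = ∑ k ∈ Finset.range (r + 1), SL[p, k] := by
  calc SB[p, r] = ∑ z ∈ box d r, ∑ k ∈ Finset.range (r + 1),
        (bondPercolation (zdGraph d) p).real {ω : BondConfig (Site d) | z ∈ level (zdGraph d) 0 k ω} :=
        Finset.sum_congr rfl fun z _ => real_mem_ball_eq_sum p z r
    _ = ∑ k ∈ Finset.range (r + 1), ∑ z ∈ box d r,
        (bondPercolation (zdGraph d) p).real {ω : BondConfig (Site d) | z ∈ level (zdGraph d) 0 k ω} := Finset.sum_comm
    _ = ∑ k ∈ Finset.range (r + 1), SL[p, k] := by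
        refine Finset.sum_congr rfl fun k hk => ?_
        rw [Finset.mem_range] at hk
        symm
        refine Finset.sum_subset (box_mono d (show k ≤ r by omega)) fun z _ hz => ?_
        exact real_mem_level_eq_zero_of_notMem_box p hz

/-- **`L_p(0) = 1`**: the `0`-th chemical sphere is `{0}`. [folklore] -/
theorem sumLevel_zero (p : unitInterval) : SL[p, 0] = 1 := by
  have hlev : ∀ (ω : BondConfig (Site d)) (z : Site d), z ∈ level (zdGraph d) 0 0 ω ↔ z = 0 := by
    intro ω z
    constructor
    · rintro ⟨hr, h0⟩
      exact ((SimpleGraph.Reachable.dist_eq_zero_iff hr).1 h0).symm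
    · rintro rfl
      exact ⟨SimpleGraph.Reachable.refl _, SimpleGraph.dist_self⟩
  have hset : ∀ z : Site d, {ω : BondConfig (Site d) | z ∈ level (zdGraph d) 0 0 ω} = if z = 0 then Set.univ else ∅ := by
    intro z
    split_ifs with h
    · exact Set.eq_univ_of_forall fun ω => (hlev ω z).2 h
    · exact Set.eq_empty_of_forall_notMem fun ω hω => h ((hlev ω z).1 hω)
  simp_rw [hset]
  rw [Finset.sum_eq_single (0 : Site d)]
  · simp
  · intro z _ hz; simp [hz]
  · intro h; exact absurd (zero_mem_box d 0) h

/-- **`P_p(Rad_int(C(0)) ≥ k) ≤ E_p|∂B_int(0,k)|`** (Markov: `{Rad_int ≥ k} = {∂B_int(0,k) ≠ ∅}`). [folklore] -/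
theorem real_far_le_sumLevel (p : unitInterval) (k : ℕ) :
    (bondPercolation (zdGraph d) p).real (far (zdGraph d) (0 : Site d) k) ≤ SL[p, k] := by
  calc (bondPercolation (zdGraph d) p).real (far (zdGraph d) (0 : Site d) k)
      ≤ (bondPercolation (zdGraph d) p).real (⋃ x ∈ box d k, {ω : BondConfig (Site d) | x ∈ level (zdGraph d) 0 k ω}) := by
        refine measureReal_mono (fun ω hω => ?_) (measure_ne_top _ _)
        obtain ⟨x, hx⟩ := level_nonempty_of_far hω le_rfl
        rw [Set.mem_iUnion₂]
        exact ⟨x, level_subset_box k ω hx, hx⟩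
    _ ≤ SL[p, k] := measureReal_biUnion_finset_le _ _

/-! ### §2. `E_p|∂B_int(0,k)| ≥ 1` for every `k`, at `p_c` and above -/

/-- **EVERY CHEMICAL SPHERE HAS EXPECTED SIZE AT LEAST ONE AT CRITICALITY**: `E_{p_c}|∂B_int(0,k)| ≥ 1` for every `k` and every
`d ≥ 2`.  If `L = E_{p_c}|∂B_int(0,k)| < 1` then file 1 gives `θ_{mk}(p_c) ≤ L^m`, exponential decay at `p_c`, against the
tree's a-priori bound `π_{p_c}(n) ≥ c n^{-(d-1)/2}`.  The constant is mean-field exact (forward regular tree: expected generation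
sizes `≡ 1` at criticality).  Hypothesis-free; p205010 not used. [cite: KozmaNachmias2009, Thm. 1.3(i) (lower bound, high d)] -/
theorem one_le_sumLevel_criticalProbI (hd : 2 ≤ d) (k : ℕ) : 1 ≤ SL[criticalProbI d, k] := by
  rcases Nat.eq_zero_or_pos k with rfl | hk
  · rw [sumLevel_zero]
  by_contra hlt
  rw [not_le] at hlt
  set s : ℝ := SL[criticalProbI d, k] with hs
  have hs0 : 0 ≤ s := sumLevel_nonneg _ _
  obtain ⟨c, hc, hlow⟩ := exists_oneArmProb_criticalProbI_lower_half hd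
  -- `c ≤ k^d · (m^d s^m)` for every `m ≥ 1`
  have hkey : ∀ m : ℕ, 1 ≤ m → c ≤ (k : ℝ) ^ d * ((m : ℝ) ^ d * s ^ m) := by
    intro m hm
    have hmk : 1 ≤ m * k := Nat.one_le_iff_ne_zero.2 (Nat.mul_ne_zero (by omega) (by omega))
    have hmk0 : (0 : ℝ) < (m * k : ℕ) := by exact_mod_cast hmk
    have hmk1 : (1 : ℝ) ≤ (m * k : ℕ) := by exact_mod_cast hmk
    have h1 := hlow (m * k) hmk
    have h2 : oneArmProb d (criticalProbI d) (m * k) ≤ s ^ m := oneArmProb_mul_le_sumLevel_pow (criticalProbI d) hk m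
    have hq0 : 0 < ((m * k : ℕ) : ℝ) ^ (((d : ℝ) - 1) / 2) := Real.rpow_pos_of_pos hmk0 _
    rw [div_le_iff₀ hq0] at h1
    -- `(mk)^{(d-1)/2} ≤ (mk)^d = m^d k^d`
    have hexp : ((m * k : ℕ) : ℝ) ^ (((d : ℝ) - 1) / 2) ≤ (k : ℝ) ^ d * (m : ℝ) ^ d := by
      calc ((m * k : ℕ) : ℝ) ^ (((d : ℝ) - 1) / 2) ≤ ((m * k : ℕ) : ℝ) ^ ((d : ℕ) : ℝ) :=
            Real.rpow_le_rpow_of_exponent_le hmk1 (by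
              have : (0 : ℝ) ≤ d := Nat.cast_nonneg d
              linarith)
        _ = (k : ℝ) ^ d * (m : ℝ) ^ d := by rw [Real.rpow_natCast]; push_cast; ring
    calc c ≤ oneArmProb d (criticalProbI d) (m * k) * ((m * k : ℕ) : ℝ) ^ (((d : ℝ) - 1) / 2) := h1
      _ ≤ s ^ m * ((k : ℝ) ^ d * (m : ℝ) ^ d) := mul_le_mul h2 hexp hq0.le (pow_nonneg hs0 m)
      _ = (k : ℝ) ^ d * ((m : ℝ) ^ d * s ^ m) := by ring
  -- but `m^d s^m → 0`
  have htend : Tendsto (fun m : ℕ => (k : ℝ) ^ d * ((m : ℝ) ^ d * s ^ m)) atTop (𝓝 ((k : ℝ) ^ d * 0)) :=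
    (tendsto_pow_const_mul_const_pow_of_abs_lt_one d (by rw [abs_of_nonneg hs0]; exact hlt)).const_mul _
  rw [mul_zero] at htend
  obtain ⟨m, hm1, hm⟩ := ((htend.eventually (gt_mem_nhds hc)).and (eventually_ge_atTop 1)).exists
  exact absurd (hkey m hm) (not_le.2 hm1)

/-- **`E_p|∂B_int(0,k)| ≥ 1` for every `k` whenever `θ(p) > 0`**: `θ(p) ≤ θ_{mk}(p) ≤ L_p(k)^m → 0` otherwise. [folklore] -/
theorem one_le_sumLevel_of_theta_pos (p : unitInterval) (hθ : 0 < theta (zdGraph d) 0 p) (k : ℕ) : 1 ≤ SL[p, k] := by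
  rcases Nat.eq_zero_or_pos k with rfl | hk
  · rw [sumLevel_zero]
  by_contra hlt
  rw [not_le] at hlt
  set s : ℝ := SL[p, k] with hs
  have hs0 : 0 ≤ s := sumLevel_nonneg _ _
  have hle : ∀ m : ℕ, theta (zdGraph d) 0 p ≤ s ^ m := fun m =>
    (theta_le_real_siteToBoundary p (m * k)).trans (oneArmProb_mul_le_sumLevel_pow p hk m)
  have htend : Tendsto (fun m : ℕ => s ^ m) atTop (𝓝 0) := tendsto_pow_atTop_nhds_zero_of_lt_one hs0 hlt
  exact absurd (ge_of_tendsto' htend hle) (not_le.2 hθ)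

/-- **`E_p|∂B_int(0,k)| ≥ 1` for every `k` and every `p ≥ p_c`** (`d ≥ 2`): at `p_c` by the a-priori one-arm bound, above by
`θ > 0`. [cite: KozmaNachmias2009, Thm. 1.3(i) (lower bound)] -/
theorem one_le_sumLevel_of_criticalProb_le (hd : 2 ≤ d) (p : unitInterval) (hp : criticalProb (zdGraph d) 0 ≤ (p : ℝ)) (k : ℕ) :
    1 ≤ SL[p, k] := by
  rcases hp.lt_or_eq with hlt | heq
  · exact one_le_sumLevel_of_theta_pos p (theta_pos_of_criticalProb_lt_holds (zdGraph d) 0 p hlt) k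
  · have hpc : p = criticalProbI d := Subtype.ext (by rw [coe_criticalProbI]; exact heq.symm)
    rw [hpc]
    exact one_le_sumLevel_criticalProbI hd k

/-! ### §3. `E_{p_c}|B_int(0,r)| ≥ r + 1` in every dimension; two-sided `≍ r` in high dimensions -/

/-- **THE CRITICAL INTRINSIC VOLUME IS AT LEAST LINEAR IN EVERY DIMENSION: `E_{p_c}|B_int(0,r)| ≥ r + 1`** for every `r` and every
`d ≥ 2` (sum of §2 over the spheres `k ≤ r`).  Kozma–Nachmias 2009 Thm 1.3(i) proves `≥ c r` for `d > 6` from the two-point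
function estimate; here there is no hypothesis and the constant is mean-field exact (forward tree: `= r + 1`).
[cite: KozmaNachmias2009, Thm. 1.3(i)] [cite: HeydenreichVanDerHofstad2017, (11.3.4) lower bound] -/
theorem sumBall_criticalProbI_ge (hd : 2 ≤ d) (r : ℕ) : (r : ℝ) + 1 ≤ SB[criticalProbI d, r] := by
  rw [sumBall_eq_sum_sumLevel]
  calc (r : ℝ) + 1 = ∑ _k ∈ Finset.range (r + 1), (1 : ℝ) := by simp
    _ ≤ ∑ k ∈ Finset.range (r + 1), SL[criticalProbI d, k] := Finset.sum_le_sum fun k _ => one_le_sumLevel_criticalProbI hd k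

/-- **`E_p|B_int(0,r)| ≥ r + 1` for every `p ≥ p_c`**, every `r`, `d ≥ 2`. [cite: KozmaNachmias2009, Thm. 1.3(i)] -/
theorem sumBall_ge_of_criticalProb_le (hd : 2 ≤ d) (p : unitInterval) (hp : criticalProb (zdGraph d) 0 ≤ (p : ℝ)) (r : ℕ) :
    (r : ℝ) + 1 ≤ SB[p, r] := by
  rw [sumBall_eq_sum_sumLevel]
  calc (r : ℝ) + 1 = ∑ _k ∈ Finset.range (r + 1), (1 : ℝ) := by simp
    _ ≤ ∑ k ∈ Finset.range (r + 1), SL[p, k] := Finset.sum_le_sum fun k _ => one_le_sumLevel_of_criticalProb_le hd p hp k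

/-- **KOZMA–NACHMIAS Thm 1.2(i) + Thm 1.3(i) UNDER THE TRIANGLE CONDITION, fully in the kernel: `r + 1 ≤ E_{p_c}|B_int(0,r)| ≤ C r`**
for all `r ≥ 1` (lower half hypothesis-free, upper half = gen 38's Sapozhnikov bound with `γ = 1`).
[cite: KozmaNachmias2009, Thm. 1.2(i), Thm. 1.3(i)] -/
theorem sumBall_criticalProbI_two_sided_of_triangle (hd : 2 ≤ d) (hT : TriangleCondition d) :
    ∃ C : ℝ, 0 < C ∧ ∀ r : ℕ, 1 ≤ r → (r : ℝ) + 1 ≤ SB[criticalProbI d, r] ∧ SB[criticalProbI d, r] ≤ C * r := by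
  obtain ⟨C, hC, h⟩ := ChemRad.sumBall_criticalProbI_le_linear_of_triangle hd hT
  exact ⟨C, hC, fun r hr => ⟨sumBall_criticalProbI_ge hd r, h r hr⟩⟩

/-- **HIGH DIMENSIONS, unconditionally: `∃ D > 6, ∀ d ≥ D, ∃ C, ∀ r ≥ 1, r + 1 ≤ E_{p_c}|B_int(0,r)| ≤ C r`** — the critical intrinsic
volume of `ℤ^d` grows linearly (`HaraSlade1990_triangleCondition_holds`; standard axioms).
[cite: KozmaNachmias2009, Thm. 1.2(i), Thm. 1.3(i)] [cite: HeydenreichVanDerHofstad2017, Thm. 11.5 (11.3.4)] -/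
theorem sumBall_criticalProbI_two_sided_high_dim :
    ∃ D : ℕ, 6 < D ∧ ∀ d : ℕ, D ≤ d → ∃ C : ℝ, 0 < C ∧ ∀ r : ℕ, 1 ≤ r →
      (r : ℝ) + 1 ≤ ∑ z ∈ box d r, (bondPercolation (zdGraph d) (criticalProbI d)).real
          {ω : BondConfig (Site d) | z ∈ ball (zdGraph d) 0 r ω} ∧
        ∑ z ∈ box d r, (bondPercolation (zdGraph d) (criticalProbI d)).real
          {ω : BondConfig (Site d) | z ∈ ball (zdGraph d) 0 r ω} ≤ C * r := by
  obtain ⟨D, hD, hT⟩ := Literature.Barriers.CriticalPhenomena.HaraSlade1990_triangleCondition_holds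
  exact ⟨D, hD, fun d hdD => sumBall_criticalProbI_two_sided_of_triangle (by omega) (hT d hdD)⟩

/-! ### §4. Below `p_c`: a small sphere exists — the chemical Hammersley criterion and a characterisation of `p_c` -/

/-- **BELOW `p_c` SOME CHEMICAL SPHERE HAS EXPECTED SIZE `< 1`**: for `0 < p < p_c` (`d ≥ 2`) there is `k ≤ χ(p) + 1` with
`E_p|∂B_int(0,k)| < 1` — otherwise `E_p|B_int(0,r)| ≥ r + 1` for every `r`, against `E_p|B_int(0,r)| ≤ χ(p) < ∞` (gen 38).
[cite: DuminilCopinTassionEM2016, Thm. 1.1 (sharpness)] -/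
theorem exists_sumLevel_lt_one_of_lt_criticalProb (hd : 2 ≤ d) (p : unitInterval)
    (hp : (p : ℝ) < criticalProb (zdGraph d) 0) :
    ∃ k : ℕ, (k : ℝ) ≤ chi d p + 1 ∧ SL[p, k] < 1 := by
  by_contra h
  push Not at h
  -- all spheres `k ≤ χ + 1` have expected size `≥ 1`; take `r = ⌊χ⌋₊ + 1`
  set r : ℕ := ⌊chi d p⌋₊ + 1 with hr
  have hχ0 : 0 ≤ chi d p := tsum_nonneg fun x => tau_nonneg p 0 x
  have hrle : ∀ k ∈ Finset.range (r + 1), 1 ≤ SL[p, k] := by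
    intro k hk
    rw [Finset.mem_range] at hk
    refine h k ?_
    have : (k : ℝ) ≤ r := by exact_mod_cast (show k ≤ r by omega)
    have hfl : (r : ℝ) ≤ chi d p + 1 := by
      rw [hr]; push_cast; linarith [Nat.floor_le hχ0]
    linarith
  have hge : (r : ℝ) + 1 ≤ SB[p, r] := by
    rw [sumBall_eq_sum_sumLevel]
    calc (r : ℝ) + 1 = ∑ _k ∈ Finset.range (r + 1), (1 : ℝ) := by simp
      _ ≤ ∑ k ∈ Finset.range (r + 1), SL[p, k] := Finset.sum_le_sum hrle
  have hle : SB[p, r] ≤ chi d p := ChemRad.sumBall_le_chi hd r p hp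
  have hlt : chi d p < (r : ℝ) := by rw [hr]; push_cast; exact Nat.lt_floor_add_one (chi d p)
  linarith

/-- **THE CHEMICAL HAMMERSLEY CRITERION, quantitative**: below `p_c` there are `k ≥ 1` and `s < 1` (`s = E_p|∂B_int(0,k)|`,
`k ≤ χ(p) + 1`) with `θ_n(p) ≤ s^{⌊n/k⌋}` for every `n`. [cite: DuminilCopinTassionEM2016, Thm. 1.1 (item 1)] -/
theorem exists_oneArmProb_le_pow_of_lt_criticalProb (hd : 2 ≤ d) (p : unitInterval)
    (hp : (p : ℝ) < criticalProb (zdGraph d) 0) :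
    ∃ k : ℕ, 1 ≤ k ∧ (k : ℝ) ≤ chi d p + 1 ∧ SL[p, k] < 1 ∧ ∀ n : ℕ, oneArmProb d p n ≤ SL[p, k] ^ (n / k) := by
  obtain ⟨k, hkχ, hk⟩ := exists_sumLevel_lt_one_of_lt_criticalProb hd p hp
  have hk1 : 1 ≤ k := by
    rcases Nat.eq_zero_or_pos k with rfl | hk1
    · rw [sumLevel_zero] at hk; exact absurd hk (lt_irrefl _)
    · exact hk1
  exact ⟨k, hk1, hkχ, hk, fun n => oneArmProb_le_pow_div p hk1 le_rfl n⟩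

/-- **CHARACTERISATION OF `p_c` BY THE CHEMICAL SPHERES**: for `0 < p` and `d ≥ 2`,
`p < p_c(ℤ^d) ⟺ ∃ k, E_p|∂B_int(0,k)| < 1`; equivalently `p ≥ p_c ⟺ E_p|∂B_int(0,k)| ≥ 1 for every k`.  So
`p_c = sup{p : some chemical sphere has expected size < 1}` — the intrinsic counterpart of Duminil-Copin–Tassion's
`p_c = p̃_c = sup{p : φ_p(S) < 1 for some finite S ∋ 0}`. [cite: DuminilCopinTassionEM2016, Thm. 1.1 and the definition of p̃_c] -/
theorem lt_criticalProb_iff_exists_sumLevel_lt_one (hd : 2 ≤ d) (p : unitInterval) :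
    (p : ℝ) < criticalProb (zdGraph d) 0 ↔ ∃ k : ℕ, SL[p, k] < 1 := by
  constructor
  · intro hp
    obtain ⟨k, -, hk⟩ := exists_sumLevel_lt_one_of_lt_criticalProb hd p hp
    exact ⟨k, hk⟩
  · rintro ⟨k, hk⟩
    by_contra hge
    rw [not_lt] at hge
    exact absurd (one_le_sumLevel_of_criticalProb_le hd p hge k) (not_le.2 hk)

/-- The contrapositive form: **`p ≥ p_c ⟺ ∀ k, E_p|∂B_int(0,k)| ≥ 1`** (`d ≥ 2`). [cite: DuminilCopinTassionEM2016, Thm. 1.1] -/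
theorem criticalProb_le_iff_forall_one_le_sumLevel (hd : 2 ≤ d) (p : unitInterval) :
    criticalProb (zdGraph d) 0 ≤ (p : ℝ) ↔ ∀ k : ℕ, 1 ≤ SL[p, k] := by
  rw [← not_lt, lt_criticalProb_iff_exists_sumLevel_lt_one hd p]
  simp only [not_exists, not_lt]

end ChemSphere

end Summit.CriticalPhenomena.PercolationContinuityZ3.Theorems

end
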